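import Literature.MathematicalPhysics.QuantumFieldTheory.Balaban1983to89.Beta.LogDetVariation

/-!
# The abelian rung of the KKT split — finite-dimensional inequalities (row BETA-an1, `HOME/BETA/AN1.md` §5.2)

HONEST FRAMING (page 1 of everything in this cell).  Discharging `BetaPertH` makes Bałaban's UV stability
UNCONDITIONAL — a real constructive-QFT result; it is NOT the continuum limit and NOT the Clay problem.  This module asserts
NOTHING about Bałaban's β-function: it is the linear algebra behind the abelian (G = U(1)) control computation of the β
sub-cell, typed so that the numerics row and the analytic rows cite ONE kernel statement.  Value = kernel bookkeeping of a
cross-check, NOT summit progress.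

## What is typed (AN1.md §5.2, PROPOSITION 5.2 (a)–(b); the lead's BETA-SPEC v1.3 §8 "KKT split")

The one-loop functional of the lead's §8 is `Γ(B) = const − ½ log det K(B) − ½ log det (Q K(B)⁻¹ Qᵀ)` with
`K = H + Qᵀ a Q` ([Balaban1985BackgroundPropagators] (3.122) p. 420 «G⁻¹ = Δ_π + DRD* + Q*aQ»; tree `Beta.KKTSplit`,
`Beta.Composition.det_kkt`).  For the ABELIAN group the only background dependence of `K(B)` is the plaquette factor
`Re U(∂p) − 1` of [Balaban1985BackgroundPropagators] (3.10) p. 392,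
«⟨A,Δ′A⟩ = Σ_{p⊂T_η} η^d tr((D¹_U A)(p))² η⁻²(Re U(∂p) − 1) + tr Σ i[A′(b₁),A′(b₂)] η⁻² Im U(∂p)»
(the commutator term vanishes for U(1)), and `cos θ − 1 = −2 sin²(θ/2) ≤ 0`.  Hence, to second order in the background,
`K(B) = K(0) − E(B)` with `E(B) = Σ_p a_p(B) · ℓ_p ℓ_pᵀ`, `a_p(B) ≥ 0`, where `ℓ_p` is the plaquette-curl functional and
`K(0) = Σ_p w_p · ℓ_p ℓ_pᵀ + N` with weights `w_p > 0` and `N ≥ 0` (gauge-fixing forms, `Qᵀ a Q`).  First-order perturbation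
of `log det` gives the three second-order coefficients as
  `h^{bulk} = ½ Σ_p a_p ⟨ℓ_p, K(0)⁻¹ ℓ_p⟩`,  `h = ½ Σ_p a_p ⟨ℓ_p, Γ ℓ_p⟩`,  `h^{unit} = h − h^{bulk}`,
with `Γ` the constrained covariance, `0 ≤ Γ ≤ K(0)⁻¹` (tree `Beta.LogDetVariation.inv_sub_compressed_inv_posSemidef`).
This file proves, for exactly these finite sums (`rungSum`):
* `dotProduct_inv_mulVec_le_inv` — the RANK-ONE SCHUR BOUND: `K` positive definite and `w (ℓ·v)² ≤ ⟨v, K v⟩` for all `v`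
  imply `⟨ℓ, K⁻¹ ℓ⟩ ≤ 1/w`;
* `rungSum_nonneg`, `rungSum_mono`, `rungSum_inv_le` and the assembled chain `abelianRung`:
  `0 ≤ h ≤ h^{bulk} ≤ ½ Σ_p a_p / w_p` and `−½ Σ_p a_p / w_p ≤ h^{unit} ≤ 0`;
* `half_trace_mul_rankOneSum` — the bridge `½ tr (G · Σ_p a_p ℓ_p ℓ_pᵀ) = rungSum G a ℓ` to the trace language of
  `Beta.LogDetVariation` (`tadpole_nonneg`).
With `a_p = ½ w_p ξ⁴ F(p)²` the bound `½ Σ_p a_p / w_p = ¼ ξ⁴ Σ_p F(p)²` is the one displayed in AN1.md §5.2 (b); its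
UNIFORMITY in the number of renormalization steps is the one printed input [Balaban1985Variational] Thm 1 (9) p. 279
(«∣∇^η A∣ < B₃Mε₁(L^jη)⁻²»), carried in the cell file as a hypothesis on `Σ_p F(p)²`, not here.
No `def … : Prop` is introduced (D-0026); `rungSum` is a real-valued definition, the rest are theorems.
Cell audit ids: GAPS C-an1-3 (kernel certificate of this file), G-an1-4 (the abelian control), AN1.md §5.3 (the η-power
correction this computation settled).
-/

namespace Literature.MathematicalPhysics.QuantumFieldTheory.Balaban1983to89.Beta.AbelianRung

open Matrix
open scoped BigOperators

variable {n : Type*} [Fintype n] [DecidableEq n]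

/-! ## §1. Rank-one quadratic forms and the rank-one Schur bound -/

omit [DecidableEq n] in
/-- `vᵀ (ℓ ℓᵀ) v = (ℓ·v)²`. [folklore] -/
theorem dotProduct_vecMulVec_mulVec (ℓ v : n → ℝ) :
    v ⬝ᵥ (vecMulVec ℓ ℓ *ᵥ v) = (ℓ ⬝ᵥ v) ^ 2 := by
  rw [Matrix.vecMulVec_mulVec, op_smul_eq_smul, dotProduct_smul, smul_eq_mul, dotProduct_comm v ℓ, sq]

omit [DecidableEq n] in
/-- `ℓᵀ G ℓ = tr (G · ℓ ℓᵀ)`: the bridge between the quadratic-form and the trace language. [folklore] -/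
theorem trace_mul_vecMulVec (G : Matrix n n ℝ) (ℓ : n → ℝ) :
    (G * vecMulVec ℓ ℓ).trace = ℓ ⬝ᵥ (G *ᵥ ℓ) := by
  rw [trace_mul_comm, vecMulVec_mul, trace_vecMulVec, dotProduct_comm, ← dotProduct_mulVec]

/-- **Rank-one Schur bound.**  If `K` is positive definite and dominates the rank-one form `w · (ℓ·v)²` (`w > 0`), then
`⟨ℓ, K⁻¹ ℓ⟩ ≤ 1/w`.  Proof: with `v := K⁻¹ ℓ`, `t := ⟨ℓ, v⟩ = ⟨v, K v⟩ ≥ w ⟨ℓ, v⟩² = w t²`, so `t ≤ 1/w`.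
(AN1.md §5.2 (b): `K(0) ≥ w_p ℓ_p ℓ_pᵀ` because every other term of `K(0)` is positive semidefinite.) [folklore] -/
theorem dotProduct_inv_mulVec_le_inv {K : Matrix n n ℝ} (hK : K.PosDef) {w : ℝ} (hw : 0 < w) (ℓ : n → ℝ)
    (hdom : ∀ v : n → ℝ, w * (ℓ ⬝ᵥ v) ^ 2 ≤ v ⬝ᵥ (K *ᵥ v)) :
    ℓ ⬝ᵥ (K⁻¹ *ᵥ ℓ) ≤ 1 / w := by
  set v : n → ℝ := K⁻¹ *ᵥ ℓ with hv
  have hKu : IsUnit K.det := (Matrix.isUnit_iff_isUnit_det K).mp hK.isUnit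
  have hKv : K *ᵥ v = ℓ := by
    rw [hv, Matrix.mulVec_mulVec, Matrix.mul_nonsing_inv K hKu, Matrix.one_mulVec]
  have h1 : v ⬝ᵥ (K *ᵥ v) = ℓ ⬝ᵥ v := by rw [hKv, dotProduct_comm]
  have h2 : w * (ℓ ⬝ᵥ v) ^ 2 ≤ ℓ ⬝ᵥ v := by simpa only [h1] using hdom v
  have ht0 : 0 ≤ ℓ ⬝ᵥ v := by
    have h := hK.posSemidef.dotProduct_mulVec_nonneg v
    simpa only [star_trivial, h1] using h
  rcases ht0.eq_or_lt with h0 | hpos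
  · rw [← h0]; positivity
  · have h3 : w * (ℓ ⬝ᵥ v) * (ℓ ⬝ᵥ v) ≤ 1 * (ℓ ⬝ᵥ v) := by
      calc w * (ℓ ⬝ᵥ v) * (ℓ ⬝ᵥ v) = w * (ℓ ⬝ᵥ v) ^ 2 := by ring
        _ ≤ ℓ ⬝ᵥ v := h2
        _ = 1 * (ℓ ⬝ᵥ v) := by ring
    have key : w * (ℓ ⬝ᵥ v) ≤ 1 := le_of_mul_le_mul_right h3 hpos
    rw [le_div_iff₀ hw, mul_comm]
    exact key

omit [DecidableEq n] in
/-- The domination hypothesis of the Schur bound from a sum-of-rank-ones decomposition of the quadratic form: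
if `⟨v, K v⟩ = Σ_p w_p (ℓ_p·v)² + ⟨v, N v⟩` with `N ≥ 0` and all `w_p ≥ 0`, then `w_{p₀} (ℓ_{p₀}·v)² ≤ ⟨v, K v⟩`.
(AN1.md §5.2: `K(0) = Σ_p w_p ℓ_p ℓ_pᵀ + 𝒩`, 𝒩 = gauge-fixing forms + `Qᵀ a Q`.) [folklore] -/
theorem rankOne_le_of_decomp {P : Type*} [Fintype P] {K N : Matrix n n ℝ} {w : P → ℝ} {ℓ : P → n → ℝ}
    (hquad : ∀ v : n → ℝ, v ⬝ᵥ (K *ᵥ v) = (∑ p, w p * (ℓ p ⬝ᵥ v) ^ 2) + v ⬝ᵥ (N *ᵥ v))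
    (hN : N.PosSemidef) (hw : ∀ p, 0 ≤ w p) (p₀ : P) (v : n → ℝ) :
    w p₀ * (ℓ p₀ ⬝ᵥ v) ^ 2 ≤ v ⬝ᵥ (K *ᵥ v) := by
  rw [hquad v]
  have hN' : 0 ≤ v ⬝ᵥ (N *ᵥ v) := by
    have h := hN.dotProduct_mulVec_nonneg v
    simpa only [star_trivial] using h
  have hsum : w p₀ * (ℓ p₀ ⬝ᵥ v) ^ 2 ≤ ∑ p, w p * (ℓ p ⬝ᵥ v) ^ 2 :=
    Finset.single_le_sum (f := fun p => w p * (ℓ p ⬝ᵥ v) ^ 2)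
      (fun p _ => mul_nonneg (hw p) (sq_nonneg _)) (Finset.mem_univ p₀)
  linarith

/-! ## §2. The rung sums `½ Σ_p a_p ⟨ℓ_p, G ℓ_p⟩` -/

/-- `rungSum G a ℓ = ½ Σ_p a_p ⟨ℓ_p, G ℓ_p⟩` — with `G = K(0)⁻¹` this is `h^{bulk}`, with `G = Γ` (constrained covariance)
it is `h`, the second-order coefficients of AN1.md §5.2 (a). [folklore] -/
noncomputable def rungSum {P : Type*} [Fintype P] (G : Matrix n n ℝ) (a : P → ℝ) (ℓ : P → n → ℝ) : ℝ :=
  (1 / 2 : ℝ) * ∑ p, a p * (ℓ p ⬝ᵥ (G *ᵥ ℓ p))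

variable {P : Type*} [Fintype P]

omit [DecidableEq n] in
/-- Bridge to the trace language of `Beta.LogDetVariation`: `½ tr (G · Σ_p a_p ℓ_p ℓ_pᵀ) = rungSum G a ℓ`
(so `h^{bulk} = ½ tr (K(0)⁻¹ E)`, `h = ½ tr (Γ E)` with `E = Σ_p a_p ℓ_p ℓ_pᵀ = −K₂`, cf. `tadpole_nonneg`). [folklore] -/
theorem half_trace_mul_rankOneSum (G : Matrix n n ℝ) (a : P → ℝ) (ℓ : P → n → ℝ) :
    (1 / 2 : ℝ) * (G * ∑ p, a p • vecMulVec (ℓ p) (ℓ p)).trace = rungSum G a ℓ := by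
  unfold rungSum
  congr 1
  rw [Matrix.mul_sum, trace_sum]
  refine Finset.sum_congr rfl fun p _ => ?_
  rw [Matrix.mul_smul, trace_smul, smul_eq_mul, trace_mul_vecMulVec]

omit [DecidableEq n] in
/-- (a) SIGN: `Γ ≥ 0` and `a_p ≥ 0` give `0 ≤ h`. [folklore] -/
theorem rungSum_nonneg {G : Matrix n n ℝ} (hG : G.PosSemidef) {a : P → ℝ} (ha : ∀ p, 0 ≤ a p) (ℓ : P → n → ℝ) :
    0 ≤ rungSum G a ℓ := by
  unfold rungSum
  refine mul_nonneg (by norm_num) (Finset.sum_nonneg fun p _ => mul_nonneg (ha p) ?_)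
  have h := hG.dotProduct_mulVec_nonneg (ℓ p)
  simpa only [star_trivial] using h

omit [DecidableEq n] in
/-- (a) MONOTONICITY: `Γ ≤ G` (i.e. `G − Γ ≥ 0`) and `a_p ≥ 0` give `h ≤ h^{bulk}`, i.e. `h^{unit} = h − h^{bulk} ≤ 0`. [folklore] -/
theorem rungSum_mono {G Γ : Matrix n n ℝ} (hGΓ : (G - Γ).PosSemidef) {a : P → ℝ} (ha : ∀ p, 0 ≤ a p)
    (ℓ : P → n → ℝ) : rungSum Γ a ℓ ≤ rungSum G a ℓ := by
  have hdiff : rungSum G a ℓ - rungSum Γ a ℓ = rungSum (G - Γ) a ℓ := by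
    unfold rungSum
    rw [← mul_sub, ← Finset.sum_sub_distrib]
    congr 1
    refine Finset.sum_congr rfl fun p _ => ?_
    rw [Matrix.sub_mulVec, dotProduct_sub, mul_sub]
  have h := rungSum_nonneg hGΓ ha ℓ
  linarith

/-- (b) THE BOUND: for `K` positive definite with `⟨v, K v⟩ = Σ_p w_p (ℓ_p·v)² + ⟨v, N v⟩`, `N ≥ 0`, `w_p > 0`, and `a_p ≥ 0`,
`h^{bulk} = rungSum K⁻¹ a ℓ ≤ ½ Σ_p a_p / w_p`.  (AN1.md §5.2 (b): with `a_p = ½ w_p ξ⁴ F(p)²` the right side is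
`¼ ξ⁴ Σ_p F(p)²`.) [folklore] -/
theorem rungSum_inv_le {K N : Matrix n n ℝ} (hK : K.PosDef) {w : P → ℝ} {ℓ : P → n → ℝ}
    (hquad : ∀ v : n → ℝ, v ⬝ᵥ (K *ᵥ v) = (∑ p, w p * (ℓ p ⬝ᵥ v) ^ 2) + v ⬝ᵥ (N *ᵥ v))
    (hN : N.PosSemidef) (hw : ∀ p, 0 < w p) {a : P → ℝ} (ha : ∀ p, 0 ≤ a p) :
    rungSum K⁻¹ a ℓ ≤ (1 / 2 : ℝ) * ∑ p, a p / w p := by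
  unfold rungSum
  refine mul_le_mul_of_nonneg_left (Finset.sum_le_sum fun p _ => ?_) (by norm_num)
  have hS : ℓ p ⬝ᵥ (K⁻¹ *ᵥ ℓ p) ≤ 1 / w p :=
    dotProduct_inv_mulVec_le_inv hK (hw p) (ℓ p) (rankOne_le_of_decomp hquad hN (fun q => (hw q).le) p)
  calc a p * (ℓ p ⬝ᵥ (K⁻¹ *ᵥ ℓ p)) ≤ a p * (1 / w p) := mul_le_mul_of_nonneg_left hS (ha p)
    _ = a p / w p := by rw [mul_one_div]

/-- **The abelian rung (AN1.md PROPOSITION 5.2 (a)–(b)).**  Data: `K = K(0)` positive definite with the decomposition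
`⟨v,Kv⟩ = Σ_p w_p (ℓ_p·v)² + ⟨v,Nv⟩`, `N ≥ 0`, `w_p > 0`; `Γ` with `0 ≤ Γ ≤ K⁻¹` (constrained covariance); coefficients
`a_p ≥ 0`.  Conclusions, with `h := rungSum Γ a ℓ`, `h^{bulk} := rungSum K⁻¹ a ℓ`, `h^{unit} := h − h^{bulk}`:
`0 ≤ h ≤ h^{bulk} ≤ ½ Σ_p a_p / w_p` and `−½ Σ_p a_p / w_p ≤ h^{unit} ≤ 0`.  Consequence recorded in the cell file: for
G = U(1) the bulk part has no `n · log L` growth and the unit part is bounded — (H1)/(H2) of BETA-SPEC §8 hold in the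
abelian theory with drift `b = 0` (no asymptotic freedom), uniformly in `n` once `Σ_p F(p)²` is bounded by the printed
regularity [Balaban1985Variational] Thm 1 (9). [folklore] -/
theorem abelianRung {K N Γ : Matrix n n ℝ} (hK : K.PosDef) {w : P → ℝ} {ℓ : P → n → ℝ}
    (hquad : ∀ v : n → ℝ, v ⬝ᵥ (K *ᵥ v) = (∑ p, w p * (ℓ p ⬝ᵥ v) ^ 2) + v ⬝ᵥ (N *ᵥ v))
    (hN : N.PosSemidef) (hw : ∀ p, 0 < w p) (hΓ : Γ.PosSemidef) (hΓK : (K⁻¹ - Γ).PosSemidef)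
    {a : P → ℝ} (ha : ∀ p, 0 ≤ a p) :
    0 ≤ rungSum Γ a ℓ ∧ rungSum Γ a ℓ ≤ rungSum K⁻¹ a ℓ ∧
      rungSum K⁻¹ a ℓ ≤ (1 / 2 : ℝ) * ∑ p, a p / w p ∧
      -((1 / 2 : ℝ) * ∑ p, a p / w p) ≤ rungSum Γ a ℓ - rungSum K⁻¹ a ℓ ∧
      rungSum Γ a ℓ - rungSum K⁻¹ a ℓ ≤ 0 := by
  have h0 := rungSum_nonneg hΓ ha ℓ
  have h1 := rungSum_mono hΓK ha ℓ
  have h2 := rungSum_inv_le hK hquad hN hw ha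
  refine ⟨h0, h1, h2, ?_, ?_⟩ <;> linarith

/-! ## §3. Non-vacuity: a one-dimensional witness -/

/-- The hypotheses of `abelianRung` are satisfiable (one coordinate, one plaquette, `K = 2`, `w = 1`, `N = 1`, `Γ = 0`,
`a = 1`), so the chain is not vacuous. [folklore] -/
theorem abelianRung_nonvacuous :
    ∃ (K N Γ : Matrix (Fin 1) (Fin 1) ℝ) (w : Fin 1 → ℝ) (ℓ : Fin 1 → Fin 1 → ℝ) (a : Fin 1 → ℝ),
      K.PosDef ∧ (∀ v, v ⬝ᵥ (K *ᵥ v) = (∑ p, w p * (ℓ p ⬝ᵥ v) ^ 2) + v ⬝ᵥ (N *ᵥ v)) ∧ N.PosSemidef ∧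
      (∀ p, 0 < w p) ∧ Γ.PosSemidef ∧ (K⁻¹ - Γ).PosSemidef ∧ (∀ p, 0 ≤ a p) := by
  refine ⟨(2 : ℝ) • 1, 1, 0, fun _ => 1, fun _ _ => 1, fun _ => 1, ?_, ?_, ?_, ?_, ?_, ?_, ?_⟩
  · exact Matrix.PosDef.one.smul (by norm_num)
  · intro v
    simp [Matrix.mulVec, dotProduct, Matrix.one_apply, sq]
    ring
  · exact Matrix.PosSemidef.one
  · intro p; norm_num
  · exact Matrix.PosSemidef.zero
  · rw [sub_zero]
    have h2 : ((2 : ℝ) • (1 : Matrix (Fin 1) (Fin 1) ℝ))⁻¹ = (1 / 2 : ℝ) • 1 :=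
      Matrix.inv_eq_left_inv (by rw [Matrix.smul_mul, Matrix.one_mul, smul_smul]; norm_num)
    rw [h2]
    exact Matrix.PosSemidef.one.smul (by norm_num)
  · intro p; norm_num

end Literature.MathematicalPhysics.QuantumFieldTheory.Balaban1983to89.Beta.AbelianRung
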